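import Summits.ValiantsHypothesis.ValiantsHypothesis.Theorems.BarrierLeverPartitionMinorsHitByVPBiadditiveDoor
import Summits.ValiantsHypothesis.ValiantsHypothesis.Theorems.BarrierLeverPartitionMinorsChowIntegerCertificates

/-!
# Route BarrierLever — item `ChowHitsPartitionMinorsR` (stmt-ValiantsHypothesis-21882): preliminaries for
# the FACE-PRIVATE design (THEOREM FP, seat memo MEMO-21882-valnp5-g29.md §6) — roots-of-unity products and
# the partition coefficients of powers of variable sums

Helper file (`--supports stmt-ValiantsHypothesis-21882`; cell valiant-natproofs, rung V4, 𝒟-side support item of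
route BarrierLever; seat val-np-p5 gen 29). Definition-free. Closes NO item. Conventions of the items: in
`MvPolynomial (Fin (h+h)) R`, `x_a = X (castAdd a)`, `y_c = X (natAdd c)`, partition exponent
`E U W = Σ_{a∈U} single (castAdd a) 1 + Σ_{c∈W} single (natAdd c) 1`; `X_V = Σ_{a∈V} x_a`, `Y_W = Σ_{c∈W} y_c`.
* `prod_range_add_algebraMap_pow_mul` — `∏_{k<n} (A + ζ^k B) = A^n − (−B)^n` in a commutative `ℂ`-algebra (ζ a
  primitive `n`-th root of unity; folklore, from Mathlib's `X^n − 1 = ∏ (X − ζ^k)`).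
* `coeff_partitionExpo_mul_eq_zero_of_forall` (invisible factors), `coeff_partitionExpo_sumY_pow`,
  `coeff_partitionExpo_sumX_pow` (`m!` at the `m`-subsets of `W` resp. `V`, zero elsewhere),
  `coeff_partitionExpo_one_add_C_mul_sumX_pow` (`(1 + a X_V)^n`: `a^{|S|} n(n−1)⋯(n−|S|+1)` at `S ⊆ V`).
* `coeff_partitionExpo_rootGroup` — the group `∏_{k<n} (1 + a X_V + ζ^k s Y_W)` (`|W| = n`) has the partition
  coefficients of `(1 + a X_V)^n` plus the single entry `−(−s)^n n!` at `(∅, W)`.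
WHAT THIS IS NOT: nothing on item 21882 yet (files `…FacePrivateColumns/Leading/Design` follow); nothing on crux
stmt-ValiantsHypothesis-14610 or on `VP` versus `VNP`.
-/

set_option linter.dupNamespace false

namespace Summit.ValiantsHypothesis.ValiantsHypothesis.Theorems.BarrierLever.ChowFacePrivate

open Finset MvPolynomial
open Summit.ValiantsHypothesis.ValiantsHypothesis.Theorems.BarrierLever.ProductStateSums
  (castAdd_ne_natAdd partitionExpo_apply_castAdd partitionExpo_apply_natAdd)
open Summit.ValiantsHypothesis.ValiantsHypothesis.Theorems.BarrierLever.BiadditiveDoor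
  (coeff_partitionExpo_mul)
open Summit.ValiantsHypothesis.ValiantsHypothesis.Theorems.BarrierLever.ChowFactor
  (coeff_partitionExpo_mul_affine coeff_partitionExpo_one)

noncomputable section

variable {h : ℕ}

/-- `X^n − 1 = ∏_{k<n} (X − ζ^k)` for a primitive `n`-th root of unity `ζ`. [folklore] -/
theorem X_pow_sub_one_eq_prod_range {n : ℕ} {ζ : ℂ} (hn : 0 < n) (hζ : IsPrimitiveRoot ζ n) :
    (Polynomial.X ^ n - 1 : Polynomial ℂ) =
      ∏ k ∈ Finset.range n, (Polynomial.X - Polynomial.C (ζ ^ k)) := by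
  classical
  haveI : NeZero n := ⟨hn.ne'⟩
  rw [Polynomial.X_pow_sub_one_eq_prod hn hζ]
  have hset : Polynomial.nthRootsFinset n (1 : ℂ) = (Finset.range n).image fun k => ζ ^ k := by
    ext x
    rw [Polynomial.mem_nthRootsFinset hn, Finset.mem_image]
    constructor
    · intro hx
      obtain ⟨i, hi, rfl⟩ := hζ.eq_pow_of_pow_eq_one hx
      exact ⟨i, Finset.mem_range.2 hi, rfl⟩
    · rintro ⟨i, -, rfl⟩
      rw [← pow_mul, mul_comm, pow_mul, hζ.pow_eq_one, one_pow]
  rw [hset, Finset.prod_image]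
  intro i hi j hj e
  exact hζ.pow_inj (Finset.mem_range.1 hi) (Finset.mem_range.1 hj) e

/-- `∏_{k<n} (1 − ζ^k w) = 1 − w^n` for complex `w`. [folklore] -/
theorem prod_one_sub_pow_mul {n : ℕ} {ζ : ℂ} (hn : 0 < n) (hζ : IsPrimitiveRoot ζ n) (w : ℂ) :
    ∏ k ∈ Finset.range n, (1 - ζ ^ k * w) = 1 - w ^ n := by
  by_cases hw : w = 0
  · simp [hw, zero_pow hn.ne']
  · have e := congrArg (Polynomial.eval w⁻¹) (X_pow_sub_one_eq_prod_range hn hζ)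
    simp only [Polynomial.eval_sub, Polynomial.eval_pow, Polynomial.eval_X, Polynomial.eval_one,
      Polynomial.eval_prod, Polynomial.eval_C] at e
    have hwn : w ^ n ≠ 0 := pow_ne_zero _ hw
    have key : w ^ n * ∏ k ∈ Finset.range n, (w⁻¹ - ζ ^ k) =
        ∏ k ∈ Finset.range n, (1 - ζ ^ k * w) := by
      rw [← Finset.card_range n, ← Finset.prod_const, Finset.card_range, ← Finset.prod_mul_distrib]
      refine Finset.prod_congr rfl fun k _ => ?_
      rw [mul_sub, mul_inv_cancel₀ hw]
      ring
    rw [← key, ← e, inv_pow, mul_sub, mul_inv_cancel₀ hwn, mul_one]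

/-- `∏_{k<n} (a + ζ^k b) = a^n − (−b)^n` for complex numbers, `a ≠ 0`. -/
theorem prod_range_add_pow_mul_complex {n : ℕ} {ζ : ℂ} (hn : 0 < n) (hζ : IsPrimitiveRoot ζ n)
    (a b : ℂ) (ha : a ≠ 0) :
    ∏ k ∈ Finset.range n, (a + ζ ^ k * b) = a ^ n - (-b) ^ n := by
  have key := prod_one_sub_pow_mul hn hζ (-b / a)
  have hfac : ∀ k ∈ Finset.range n, a + ζ ^ k * b = a * (1 - ζ ^ k * (-b / a)) := fun k _ => by
    rw [mul_sub, mul_one, mul_comm (ζ ^ k) (-b / a), ← mul_assoc, mul_div_cancel₀ (-b) ha]; ring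
  rw [Finset.prod_congr rfl hfac, Finset.prod_mul_distrib, Finset.prod_const, Finset.card_range, key,
    div_pow, mul_sub, mul_one, mul_div_cancel₀ _ (pow_ne_zero n ha)]

/-- The two-variable polynomial identity `∏_{k<n} (X₀ + ζ^k X₁) = X₀^n − (−X₁)^n` over `ℂ`. -/
theorem prod_range_add_pow_mul_mvPolynomial {n : ℕ} {ζ : ℂ} (hn : 0 < n) (hζ : IsPrimitiveRoot ζ n) :
    ∏ k ∈ Finset.range n, (X 0 + C (ζ ^ k) * X 1 : MvPolynomial (Fin 2) ℂ) =
      X 0 ^ n - (-X 1) ^ n := by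
  refine MvPolynomial.funext_set (fun i : Fin 2 => if i = 0 then ({0}ᶜ : Set ℂ) else Set.univ)
    (fun i => ?_) (fun x hx => ?_)
  · by_cases hi : i = 0
    · rw [if_pos hi]; exact (Set.finite_singleton (0 : ℂ)).infinite_compl
    · rw [if_neg hi]; exact Set.infinite_univ
  · have hx0 : x 0 ≠ 0 := by
      have h0 := hx 0 (Set.mem_univ _)
      dsimp only at h0
      rw [if_pos rfl] at h0
      exact Set.mem_compl_singleton_iff.mp h0
    simp only [map_prod, map_add, map_mul, map_sub, map_pow, map_neg, eval_X, eval_C]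
    exact prod_range_add_pow_mul_complex hn hζ (x 0) (x 1) hx0

/-- **`∏_{k<n} (A + ζ^k B) = A^n − (−B)^n`** for commuting `A, B` in a commutative `ℂ`-algebra and a
primitive `n`-th root of unity `ζ`. -/
theorem prod_range_add_algebraMap_pow_mul {S : Type*} [CommRing S] [Algebra ℂ S] {n : ℕ} {ζ : ℂ}
    (hn : 0 < n) (hζ : IsPrimitiveRoot ζ n) (A B : S) :
    ∏ k ∈ Finset.range n, (A + algebraMap ℂ S ζ ^ k * B) = A ^ n - (-B) ^ n := by
  have key := congrArg (MvPolynomial.aeval (![A, B] : Fin 2 → S))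
    (prod_range_add_pow_mul_mvPolynomial hn hζ)
  simp only [map_prod, map_add, map_mul, map_sub, map_pow, map_neg, aeval_X, aeval_C,
    Matrix.cons_val_zero, Matrix.cons_val_one] at key
  exact key

/-- A factor whose partition coefficients all vanish kills the partition coefficients of a product. -/
theorem coeff_partitionExpo_mul_eq_zero_of_forall {R : Type*} [CommSemiring R]
    (g f : MvPolynomial (Fin (h + h)) R)
    (hg : ∀ U W : Finset (Fin h), coeff (∑ a ∈ U, Finsupp.single (Fin.castAdd h a) 1 +
      ∑ c ∈ W, Finsupp.single (Fin.natAdd h c) 1) g = 0)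
    (U W : Finset (Fin h)) :
    coeff (∑ a ∈ U, Finsupp.single (Fin.castAdd h a) 1 + ∑ c ∈ W, Finsupp.single (Fin.natAdd h c) 1)
      (g * f) = 0 := by
  rw [coeff_partitionExpo_mul]
  refine Finset.sum_eq_zero fun S _ => Finset.sum_eq_zero fun T _ => ?_
  rw [hg S T, zero_mul]

/-- `Y_W = Σ_{c∈W} y_c` as an affine form with constant `0`, no `x`-part and indicator `y`-part. -/
theorem sumY_eq_affine {R : Type*} [CommSemiring R] (W : Finset (Fin h)) :
    (∑ c ∈ W, X (Fin.natAdd h c) : MvPolynomial (Fin (h + h)) R) =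
      C 0 + ∑ a : Fin h, C (0 : R) * X (Fin.castAdd h a) +
        ∑ c : Fin h, C (if c ∈ W then (1 : R) else 0) * X (Fin.natAdd h c) := by
  classical
  simp only [C_0, zero_mul, Finset.sum_const_zero, zero_add]
  rw [← Finset.sum_filter_add_sum_filter_not Finset.univ (fun c => c ∈ W)]
  rw [Finset.filter_univ_mem]
  have h2 : ∑ c ∈ Finset.univ.filter (fun c => ¬ c ∈ W),
      C (if c ∈ W then (1 : R) else 0) * X (Fin.natAdd h c) = (0 : MvPolynomial (Fin (h + h)) R) :=
    Finset.sum_eq_zero fun c hc => by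
      rw [Finset.mem_filter] at hc
      rw [if_neg hc.2, C_0, zero_mul]
  rw [h2, add_zero]
  exact Finset.sum_congr rfl fun c hc => by rw [if_pos hc, C_1, one_mul]

/-- `X_V = Σ_{a∈V} x_a` as an affine form with constant `0`, indicator `x`-part and no `y`-part. -/
theorem sumX_eq_affine {R : Type*} [CommSemiring R] (V : Finset (Fin h)) :
    (∑ a ∈ V, X (Fin.castAdd h a) : MvPolynomial (Fin (h + h)) R) =
      C 0 + ∑ a : Fin h, C (if a ∈ V then (1 : R) else 0) * X (Fin.castAdd h a) +
        ∑ c : Fin h, C (0 : R) * X (Fin.natAdd h c) := by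
  classical
  simp only [C_0, zero_mul, Finset.sum_const_zero, zero_add, add_zero]
  rw [← Finset.sum_filter_add_sum_filter_not Finset.univ (fun a => a ∈ V)]
  rw [Finset.filter_univ_mem]
  have h2 : ∑ a ∈ Finset.univ.filter (fun a => ¬ a ∈ V),
      C (if a ∈ V then (1 : R) else 0) * X (Fin.castAdd h a) = (0 : MvPolynomial (Fin (h + h)) R) :=
    Finset.sum_eq_zero fun a ha => by
      rw [Finset.mem_filter] at ha
      rw [if_neg ha.2, C_0, zero_mul]
  rw [h2, add_zero]
  exact Finset.sum_congr rfl fun a ha => by rw [if_pos ha, C_1, one_mul]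

/-- Multiplying by `Y_W`: `coeff (E U T) (f · Y_W) = Σ_{c ∈ T} [c ∈ W] · coeff (E U (T.erase c)) f`. -/
theorem coeff_partitionExpo_mul_sumY {R : Type*} [CommSemiring R]
    (f : MvPolynomial (Fin (h + h)) R) (W U T : Finset (Fin h)) :
    coeff (∑ a ∈ U, Finsupp.single (Fin.castAdd h a) 1 + ∑ c ∈ T, Finsupp.single (Fin.natAdd h c) 1)
        (f * ∑ c ∈ W, X (Fin.natAdd h c)) =
      ∑ c ∈ T, (if c ∈ W then (1 : R) else 0) * coeff (∑ a ∈ U, Finsupp.single (Fin.castAdd h a) 1 +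
          ∑ c' ∈ T.erase c, Finsupp.single (Fin.natAdd h c') 1) f := by
  classical
  rw [sumY_eq_affine W, coeff_partitionExpo_mul_affine]
  simp only [zero_mul, Finset.sum_const_zero, zero_add]

/-- Multiplying by `X_V`: `coeff (E S T) (f · X_V) = Σ_{a ∈ S} [a ∈ V] · coeff (E (S.erase a) T) f`. -/
theorem coeff_partitionExpo_mul_sumX {R : Type*} [CommSemiring R]
    (f : MvPolynomial (Fin (h + h)) R) (V S T : Finset (Fin h)) :
    coeff (∑ a ∈ S, Finsupp.single (Fin.castAdd h a) 1 + ∑ c ∈ T, Finsupp.single (Fin.natAdd h c) 1)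
        (f * ∑ a ∈ V, X (Fin.castAdd h a)) =
      ∑ a ∈ S, (if a ∈ V then (1 : R) else 0) * coeff (∑ a' ∈ S.erase a, Finsupp.single (Fin.castAdd h a') 1 +
          ∑ c ∈ T, Finsupp.single (Fin.natAdd h c) 1) f := by
  classical
  rw [sumX_eq_affine V, coeff_partitionExpo_mul_affine]
  simp only [zero_mul, Finset.sum_const_zero, zero_add, add_zero]

/-- **Partition coefficients of `Y_W^m`**: `m!` at `(∅, T)` for `T ⊆ W` with `|T| = m`, else `0`. -/
theorem coeff_partitionExpo_sumY_pow {R : Type*} [CommRing R] (W : Finset (Fin h)) :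
    ∀ (m : ℕ) (U T : Finset (Fin h)),
    coeff (∑ a ∈ U, Finsupp.single (Fin.castAdd h a) 1 + ∑ c ∈ T, Finsupp.single (Fin.natAdd h c) 1)
      ((∑ c ∈ W, X (Fin.natAdd h c) : MvPolynomial (Fin (h + h)) R) ^ m) =
      if U = ∅ ∧ T ⊆ W ∧ T.card = m then (m.factorial : R) else 0 := by
  classical
  intro m
  induction m with
  | zero =>
    intro U T
    rw [pow_zero, coeff_partitionExpo_one R, Nat.factorial_zero, Nat.cast_one]
    by_cases hU : U = ∅
    · by_cases hT : T = ∅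
      · subst hT; rw [if_pos ⟨hU, rfl⟩, if_pos ⟨hU, Finset.empty_subset _, Finset.card_empty⟩]
      · rw [if_neg (fun hh => hT hh.2), if_neg (fun hh => hT (Finset.card_eq_zero.mp hh.2.2))]
    · rw [if_neg (fun hh => hU hh.1), if_neg (fun hh => hU hh.1)]
  | succ m ih =>
    intro U T
    rw [pow_succ, coeff_partitionExpo_mul_sumY]
    by_cases hU : U = ∅
    · subst hU
      by_cases hTW : T ⊆ W
      · have hterm : ∀ c ∈ T, (if c ∈ W then (1 : R) else 0) *
            coeff (∑ a ∈ (∅ : Finset (Fin h)), Finsupp.single (Fin.castAdd h a) 1 +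
              ∑ c' ∈ T.erase c, Finsupp.single (Fin.natAdd h c') 1)
              ((∑ c ∈ W, X (Fin.natAdd h c) : MvPolynomial (Fin (h + h)) R) ^ m) =
            if T.card = m + 1 then (m.factorial : R) else 0 := by
          intro c hc
          rw [if_pos (hTW hc), one_mul, ih]
          have hsub : T.erase c ⊆ W := (Finset.erase_subset c T).trans hTW
          have hcard : (T.erase c).card = T.card - 1 := Finset.card_erase_of_mem hc
          have hpos : 0 < T.card := Finset.card_pos.mpr ⟨c, hc⟩
          by_cases hm : T.card = m + 1
          · rw [if_pos ⟨rfl, hsub, by omega⟩, if_pos hm]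
          · rw [if_neg (fun hh => hm (by omega)), if_neg hm]
        rw [Finset.sum_congr rfl hterm, Finset.sum_const, nsmul_eq_mul]
        by_cases hm : T.card = m + 1
        · rw [if_pos hm, if_pos ⟨rfl, hTW, hm⟩, hm, Nat.factorial_succ, Nat.cast_mul, Nat.cast_succ]
        · rw [if_neg hm, mul_zero, if_neg (fun hh => hm hh.2.2)]
      · -- some `c₀ ∈ T \ W`: every term vanishes
        obtain ⟨c₀, hc₀T, hc₀W⟩ := Finset.not_subset.mp hTW
        rw [if_neg (show ¬((∅ : Finset (Fin h)) = ∅ ∧ T ⊆ W ∧ T.card = m + 1) from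
          fun hh => hTW hh.2.1)]
        refine Finset.sum_eq_zero fun c hc => ?_
        by_cases hcW : c ∈ W
        · rw [if_pos hcW, one_mul, ih,
            if_neg (show ¬((∅ : Finset (Fin h)) = ∅ ∧ T.erase c ⊆ W ∧ (T.erase c).card = m) from ?_)]
          rintro ⟨-, hsub, -⟩
          have : c₀ ∈ T.erase c := Finset.mem_erase.mpr ⟨fun e => hc₀W (e ▸ hcW), hc₀T⟩
          exact hc₀W (hsub this)
        · rw [if_neg hcW, zero_mul]
    · rw [if_neg (show ¬(U = ∅ ∧ T ⊆ W ∧ T.card = m + 1) from fun hh => hU hh.1)]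
      refine Finset.sum_eq_zero fun c _ => ?_
      rw [ih, if_neg (show ¬(U = ∅ ∧ T.erase c ⊆ W ∧ (T.erase c).card = m) from fun hh => hU hh.1),
        mul_zero]

/-- **Partition coefficients of `X_V^m`**: `m!` at `(S, ∅)` for `S ⊆ V` with `|S| = m`, else `0`. -/
theorem coeff_partitionExpo_sumX_pow {R : Type*} [CommRing R] (V : Finset (Fin h)) :
    ∀ (m : ℕ) (S T : Finset (Fin h)),
    coeff (∑ a ∈ S, Finsupp.single (Fin.castAdd h a) 1 + ∑ c ∈ T, Finsupp.single (Fin.natAdd h c) 1)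
      ((∑ a ∈ V, X (Fin.castAdd h a) : MvPolynomial (Fin (h + h)) R) ^ m) =
      if T = ∅ ∧ S ⊆ V ∧ S.card = m then (m.factorial : R) else 0 := by
  classical
  intro m
  induction m with
  | zero =>
    intro S T
    rw [pow_zero, coeff_partitionExpo_one R, Nat.factorial_zero, Nat.cast_one]
    by_cases hT : T = ∅
    · by_cases hS : S = ∅
      · subst hS; rw [if_pos ⟨rfl, hT⟩, if_pos ⟨hT, Finset.empty_subset _, Finset.card_empty⟩]
      · rw [if_neg (fun hh => hS hh.1), if_neg (fun hh => hS (Finset.card_eq_zero.mp hh.2.2))]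
    · rw [if_neg (fun hh => hT hh.2), if_neg (fun hh => hT hh.1)]
  | succ m ih =>
    intro S T
    rw [pow_succ, coeff_partitionExpo_mul_sumX]
    by_cases hT : T = ∅
    · subst hT
      by_cases hSV : S ⊆ V
      · have hterm : ∀ a ∈ S, (if a ∈ V then (1 : R) else 0) *
            coeff (∑ a' ∈ S.erase a, Finsupp.single (Fin.castAdd h a') 1 +
              ∑ c ∈ (∅ : Finset (Fin h)), Finsupp.single (Fin.natAdd h c) 1)
              ((∑ a ∈ V, X (Fin.castAdd h a) : MvPolynomial (Fin (h + h)) R) ^ m) =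
            if S.card = m + 1 then (m.factorial : R) else 0 := by
          intro a ha
          rw [if_pos (hSV ha), one_mul, ih]
          have hsub : S.erase a ⊆ V := (Finset.erase_subset a S).trans hSV
          have hcard : (S.erase a).card = S.card - 1 := Finset.card_erase_of_mem ha
          have hpos : 0 < S.card := Finset.card_pos.mpr ⟨a, ha⟩
          by_cases hm : S.card = m + 1
          · rw [if_pos ⟨rfl, hsub, by omega⟩, if_pos hm]
          · rw [if_neg (fun hh => hm (by omega)), if_neg hm]
        rw [Finset.sum_congr rfl hterm, Finset.sum_const, nsmul_eq_mul]
        by_cases hm : S.card = m + 1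
        · rw [if_pos hm, if_pos ⟨rfl, hSV, hm⟩, hm, Nat.factorial_succ, Nat.cast_mul, Nat.cast_succ]
        · rw [if_neg hm, mul_zero, if_neg (fun hh => hm hh.2.2)]
      · obtain ⟨a₀, ha₀S, ha₀V⟩ := Finset.not_subset.mp hSV
        rw [if_neg (show ¬((∅ : Finset (Fin h)) = ∅ ∧ S ⊆ V ∧ S.card = m + 1) from
          fun hh => hSV hh.2.1)]
        refine Finset.sum_eq_zero fun a ha => ?_
        by_cases haV : a ∈ V
        · rw [if_pos haV, one_mul, ih,
            if_neg (show ¬((∅ : Finset (Fin h)) = ∅ ∧ S.erase a ⊆ V ∧ (S.erase a).card = m) from ?_)]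
          rintro ⟨-, hsub, -⟩
          have : a₀ ∈ S.erase a := Finset.mem_erase.mpr ⟨fun e => ha₀V (e ▸ haV), ha₀S⟩
          exact ha₀V (hsub this)
        · rw [if_neg haV, zero_mul]
    · rw [if_neg (show ¬(T = ∅ ∧ S ⊆ V ∧ S.card = m + 1) from fun hh => hT hh.1)]
      refine Finset.sum_eq_zero fun a _ => ?_
      rw [ih, if_neg (show ¬(T = ∅ ∧ S.erase a ⊆ V ∧ (S.erase a).card = m) from fun hh => hT hh.1),
        mul_zero]

/-- **Partition coefficients of `(1 + a X_V)^n`**: `a^{|S|} · n (n−1) ⋯ (n−|S|+1)` at `(S, ∅)`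
for `S ⊆ V`, else `0`. -/
theorem coeff_partitionExpo_one_add_C_mul_sumX_pow {R : Type*} [CommRing R] (V : Finset (Fin h))
    (a : R) (n : ℕ) (S T : Finset (Fin h)) :
    coeff (∑ a ∈ S, Finsupp.single (Fin.castAdd h a) 1 + ∑ c ∈ T, Finsupp.single (Fin.natAdd h c) 1)
      ((1 + C a * ∑ a ∈ V, X (Fin.castAdd h a) : MvPolynomial (Fin (h + h)) R) ^ n) =
      if T = ∅ ∧ S ⊆ V then a ^ S.card * (n.descFactorial S.card : R) else 0 := by
  classical
  rw [add_comm (1 : MvPolynomial (Fin (h + h)) R) (C a * ∑ a ∈ V, X (Fin.castAdd h a)), add_pow]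
  simp only [one_pow, mul_one, coeff_sum]
  have hterm : ∀ m ∈ Finset.range (n + 1),
      coeff (∑ a ∈ S, Finsupp.single (Fin.castAdd h a) 1 + ∑ c ∈ T, Finsupp.single (Fin.natAdd h c) 1)
        ((C a * ∑ a ∈ V, X (Fin.castAdd h a) : MvPolynomial (Fin (h + h)) R) ^ m *
          (n.choose m : MvPolynomial _ R)) =
        if T = ∅ ∧ S ⊆ V ∧ S.card = m then a ^ m * ((m.factorial * n.choose m : ℕ) : R) else 0 := by
    intro m _
    rw [← map_natCast (C : R →+* MvPolynomial (Fin (h + h)) R), mul_comm, coeff_C_mul, mul_pow,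
      ← C_pow, coeff_C_mul, coeff_partitionExpo_sumX_pow]
    by_cases hc : T = ∅ ∧ S ⊆ V ∧ S.card = m
    · rw [if_pos hc, if_pos hc, Nat.cast_mul]; ring
    · rw [if_neg hc, if_neg hc, mul_zero, mul_zero]
  rw [Finset.sum_congr rfl hterm]
  by_cases hc : T = ∅ ∧ S ⊆ V
  · rw [if_pos hc]
    by_cases hle : S.card ≤ n
    · rw [Finset.sum_eq_single S.card]
      · rw [if_pos ⟨hc.1, hc.2, rfl⟩, Nat.descFactorial_eq_factorial_mul_choose]
      · intro m _ hm
        rw [if_neg (fun hh => hm hh.2.2.symm)]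
      · intro hS
        exact absurd (Finset.mem_range.mpr (Nat.lt_succ_of_le hle)) hS
    · rw [Finset.sum_eq_zero, Nat.descFactorial_eq_zero_iff_lt.mpr (by omega), Nat.cast_zero, mul_zero]
      intro m hm
      rw [if_neg]
      rintro ⟨-, -, hsm⟩
      have := Finset.mem_range.mp hm
      omega
  · rw [if_neg hc]
    exact Finset.sum_eq_zero fun m _ => by rw [if_neg (fun hh => hc ⟨hh.1, hh.2.1⟩)]

/-- **Partition coefficients of the group `∏_{k<n} (1 + a X_V + ζ^k s Y_W)`** (`|W| = n ≥ 1`,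
`ζ` a primitive `n`-th root of unity): those of `(1 + a X_V)^n`, plus `−(−s)^n · n!` at `(∅, W)`. -/
theorem coeff_partitionExpo_rootGroup {R : Type*} [CommRing R] [Algebra ℂ R] {n : ℕ} {ζ : ℂ}
    (hn : 0 < n) (hζ : IsPrimitiveRoot ζ n) (V W : Finset (Fin h)) (hW : W.card = n) (a s : R)
    (S T : Finset (Fin h)) :
    coeff (∑ a ∈ S, Finsupp.single (Fin.castAdd h a) 1 + ∑ c ∈ T, Finsupp.single (Fin.natAdd h c) 1)
      (∏ k ∈ Finset.range n, ((1 + C a * ∑ a ∈ V, X (Fin.castAdd h a)) +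
        C (algebraMap ℂ R (ζ ^ k) * s) * ∑ c ∈ W, X (Fin.natAdd h c) :
          MvPolynomial (Fin (h + h)) R)) =
      (if T = ∅ ∧ S ⊆ V then a ^ S.card * (n.descFactorial S.card : R) else 0) +
        (if S = ∅ ∧ T = W then -((-s) ^ n * (n.factorial : R)) else 0) := by
  classical
  have hprod : (∏ k ∈ Finset.range n, ((1 + C a * ∑ a ∈ V, X (Fin.castAdd h a)) +
        C (algebraMap ℂ R (ζ ^ k) * s) * ∑ c ∈ W, X (Fin.natAdd h c) :
          MvPolynomial (Fin (h + h)) R)) =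
      (1 + C a * ∑ a ∈ V, X (Fin.castAdd h a)) ^ n -
        (-(C s * ∑ c ∈ W, X (Fin.natAdd h c))) ^ n := by
    have e := prod_range_add_algebraMap_pow_mul (S := MvPolynomial (Fin (h + h)) R) hn hζ
      (1 + C a * ∑ a ∈ V, X (Fin.castAdd h a)) (C s * ∑ c ∈ W, X (Fin.natAdd h c))
    rw [← e]
    refine Finset.prod_congr rfl fun k _ => ?_
    rw [← map_pow, MvPolynomial.algebraMap_apply, map_mul, mul_assoc]
  rw [hprod, coeff_sub, sub_eq_add_neg, coeff_partitionExpo_one_add_C_mul_sumX_pow, ← neg_mul,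
    ← map_neg C, mul_pow, ← C_pow, coeff_C_mul, coeff_partitionExpo_sumY_pow]
  congr 1
  by_cases hc : S = ∅ ∧ T = W
  · obtain ⟨rfl, rfl⟩ := hc
    rw [if_pos ⟨rfl, subset_refl _, hW⟩, if_pos ⟨rfl, rfl⟩]
  · rw [if_neg hc, if_neg, mul_zero, neg_zero]
    rintro ⟨hS, hTW, hTc⟩
    exact hc ⟨hS, Finset.eq_of_subset_of_card_le hTW (by omega)⟩

end

end Summit.ValiantsHypothesis.ValiantsHypothesis.Theorems.BarrierLever.ChowFacePrivate
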